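import Summits.BirchSwinnertonDyer.Rank1Residual.X9.IwasawaLowerBound
import Summits.BirchSwinnertonDyer.Rank1Residual.X9.ChaDescentRecordsS4
import Summits.BirchSwinnertonDyer.Rank1Residual.X9.ChaDescentRecordsS4b
import HarnessLib

/-!
# Class X9, `p = 5`, rank `0`, `ord₅ #Ш_an = 2`: the `5S4` SHA rows closed with NO descent and NO GRH — Cha upper half + the
# two-engine `μ(𝓛₅(E)) = 0` certificate as lower half (per-pair kernel records, part 1: `38088v1`, `464648c1`, `219024bv1`, `219024bv2` + the record shape)

HONEST FRAMING (cell `b2b-bsdres-*`, verbatim): the cell deletes COMBINATION-SHAPED residual classes of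
the rank-≤1 BSD formula from PUBLISHED theorems only and TYPES the construction-shaped remainder; this
is not "finishing BSD". Class X9 stays TYPED at class level; everything here is PER PAIR; no lane verdict
is changed; no named fact; nothing is booked by this unit (the lane books, the referee rules).
Unit `b2b-bsdres-x9`, gen 15.

Gen 13's records `X9/ChaDescentRecordsS4{,b}.lean` close the `5S4` SHA rows of the X9 census (`r_an = 0`,
`#Ш_an ∈ {25, 100}`, a two-engine Heegner-index row with `ord₅ [E(K):ℤy_K] ≤ 1`) as UPPER half Cha 2005 (= Miller
2011 Thm. 5.2) + LOWER half an exact `5`-descent `Sel⁵(E) ≠ 0` + Cassels–Tate; for eight of them (`38088v1`,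
`464648c1`, `219024bv1/bv2`, `272484k1/k2`, `374544bm1/bm2`) that descent line's class-group step is GRH-conditional
(degree-24 field, Zimmert bound out of reach) — after referee A's ROUND 197 two are booked LITERAL (`38088v`,
`464648c`) and three 'cell closed, class still residue' (`219024bv`, `272484k`, `374544bm`). HERE the lower half is
replaced by gen 9's GRH-FREE one (`X9/IwasawaLowerBound.lean`, `bsdp_of_cha_of_unitCoeff_of_analyticRank_eq_zero`):
BCS 2025 Thm. 1.1.2 (a) + Greenberg Thm. 4.1 + the period unit + modularity + GZK and ONE finite certificate
`μ(𝓛₅(E)) = 0` give `ord₅ #Ш(E) ≥ ord₅ #Ш_an(E) = 2`; with Cha's `ord₅ #Ш(E) ≤ 2·ord₅ [E(K):ℤy_K] ≤ 2` this is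
`BSD(E,5)`. So each record below has, besides PUBLISHED binders (`hBCS`, `hGr`, `h5`, `hmodP`, `hmodL`, `hGZK`, `hCha`),
only FINITE certificate binders — `r_an = 0`, the Heegner field/point with its two-engine index row (`ord₅ ≤ 1`),
`#Ш_an = q` with `ord₅ q = 2` (Cremona / the cell's engines), and `hcert` = one `5`-adic unit coefficient of
`ϖ·L₅(f_E, α)` (gen 9 `HOME/b2b-bsdres-x9/g9/mu/MU-ALL.tsv`: engines B (PARI-free modular symbols) and C (twisted
`L`-values), `λ = 2` on every row here) — and NO descent, NO class group, NO GRH, NO Jetchev. Galois / CM /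
reduction data DECIDED IN THE KERNEL from the integer model (x11c's `IntModel` toolkit as in gen 13/14:
`j ∉` the thirteen CM values, `5 ∤ Δ` and `#Ẽ(𝔽₅)` (good ORDINARY), gen 13's Frobenius point counts `card_c<label>_ℓ`
(`E[5]` irreducible, Mazur 1978 Prop. 6.3 (1)), Kraus' bounded minimality criterion, `Δ ≠ 0`).

References: B. Cha, J. Number Theory 111 (2005) = Miller 2011 Thm. 5.2 [Miller2011LMS]; Burungale–Castella–Skinner IMRN
2025 Thm. 1.1.2 (a); Greenberg LNM 1716 Thm. 4.1; Mazur 1978 Prop. 6.3 (1); Silverman AEC VII.1; Cremona's tables.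
-/

set_option autoImplicit false

noncomputable section

open scoped Classical MatrixGroups ModularForm

open CongruenceSubgroup WeierstrassCurve Literature.NumberTheory.EllipticCurves
  Literature.NumberTheory.EllipticCurves.ModularForms Literature.NumberTheory.EllipticCurves.Rank1Residual
  Literature.NumberTheory.EllipticCurves.Rank1Residual.Typed
  Literature.NumberTheory.EllipticCurves.Rank1Residual.X11RankOneCertificates
  Summit.BirchSwinnertonDyer.BirchSwinnertonDyer.Rank1Residual.IntModel
  Summit.BirchSwinnertonDyer.BirchSwinnertonDyer.Rank1Residual.X11RankOne
  Summit.BirchSwinnertonDyer.Rank1Residual.X11b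

namespace Summit.BirchSwinnertonDyer.Rank1Residual.X9

/-! ### §1. The record shape: rank `0`, `ord_p #Ш_an = 2`, Cha upper half + unit-coefficient lower half, integer model -/

/-- **`BSD(E,p)` (rank `0`, `ord_p #Ш_an = 2`) from Cha's index bound (UPPER) and the `μ(𝓛_p(E)) = 0` certificate (LOWER), for a
globally minimal `W/ℚ` with integral model `[a₁,…,a₆]`, every Galois / CM / reduction hypothesis from DECIDABLE integer data**:
`5 ≤ p`; `j = c₄³/Δ ∉` the thirteen CM `j`-invariants; `p ∤ Δ` and `#Ẽ(𝔽_p) = n_p` with `p ∤ p + 1 − n_p` (good ORDINARY); a good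
prime `ℓ ≠ p` with `#Ẽ(𝔽_ℓ) = n` and `X² − (ℓ + 1 − n)X + ℓ` root-free mod `p` (`E[p]` irreducible). PUBLISHED binders `hBCS`, `hGr`,
`h5`, `hmodP`, `hmodL`, `hGZK`, `hCha`; certificate binders: `r_an = 0`, the Heegner field `K` (`p ∤ d_K`, `p² ∤ N`) and point `P` of
infinite order with `ord_p [E(K) : ℤP] ≤ 1`, `#Ш_an = q` with `ord_p q = 2`, and `hcert` (one unit coefficient of `ϖ·L_p(f_E, α)`).
Composition of gen 9's `bsdp_of_cha_of_unitCoeff_of_analyticRank_eq_zero` (`k = 1`) with the `IntModel` toolkit. Per pair.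
[cite: Miller2011LMS, Thm. 5.2 and Def. 1.1] [cite: BurungaleCastellaSkinner2025, Thm. 1.1.2 (a) (p. 2 of arXiv:2405.00270v2)]
[cite: Mazur1978, §6 Prop. 6.3 (1) (p. 153)] [cite: SilvermanAEC2009, App. C §11] -/
theorem bsdp_of_ainvs_of_cha_of_unitCoeff
    (hBCS : burungale_castella_skinner_charIdeal_eq_padicLFunction)
    (hGr : greenberg_charValue_rankZero) (h5 : realPeriodRat_eq_unit_mul_plusPeriod)
    (hmodP : nonempty_modularParametrizationData) (hmodL : hasEntireLFunction_rat)
    (hGZK : rank_eq_analyticRank_of_analyticRank_le_one) (hCha : Cha2005.thm52_padicValNat_shaOrder_le)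
    (a1 a2 a3 a4 a6 : ℤ) {W : WeierstrassCurve ℚ} [W.IsElliptic] [W.IsGloballyMinimal]
    (hW : integralModelInt W = ⟨a1, a2, a3, a4, a6⟩) (p ℓ n np : ℕ) [Fact p.Prime] [Fact ℓ.Prime] (hp : 5 ≤ p)
    (hj : ((c4Of [a1, a2, a3, a4, a6] ^ 3 : ℤ) : ℚ) / ((discOf [a1, a2, a3, a4, a6] : ℤ) : ℚ) ∉ cmJInvariants)
    (hpΔ : ¬ (p : ℤ) ∣ discOf [a1, a2, a3, a4, a6])
    (hcardp : Nat.card (((⟨a1, a2, a3, a4, a6⟩ : WeierstrassCurve ℤ).map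
      (Int.castRingHom (ZMod p))).toAffine.Point) = np)
    (hordp : ¬ (p : ℤ) ∣ (p : ℤ) + 1 - np)
    (hℓp : ℓ ≠ p) (hℓΔ : ¬ (ℓ : ℤ) ∣ discOf [a1, a2, a3, a4, a6])
    (hcard : Nat.card (((⟨a1, a2, a3, a4, a6⟩ : WeierstrassCurve ℤ).map
      (Int.castRingHom (ZMod ℓ))).toAffine.Point) = n)
    (hnoroot : ∀ t : ℕ, t < p → ¬ (p : ℤ) ∣ (t : ℤ) ^ 2 - ((ℓ : ℤ) + 1 - n) * t + ℓ)
    (hr : W.analyticRank = 0)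
    {N : ℕ} [NeZero N] {K : Type} [Field K] [NumberField K] (hK : IsImaginaryQuadratic K)
    (hH : SatisfiesHeegnerHypothesis N K) {P : (W.baseChange K).toAffine.Point}
    (hP : IsHeegnerPoint N W K P) (hnt : ¬ IsOfFinAddOrder P)
    (hpD : ¬ (p : ℤ) ∣ NumberField.discr K) (hpN : ¬ p ^ 2 ∣ N)
    (hI : padicValNat p (AddSubgroup.zmultiples P).index ≤ 1)
    {q : ℚ} (hq : shaAn W = (q : ℂ)) (hv : padicValRat p q = 2)
    (hcert : ∀ [NeZero (W.conductorNorm ℤ)] (f : CuspForm (Gamma0 (W.conductorNorm ℤ)) 2),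
        IsNewformOf W f → ∀ (ϖ : ℚ), (ϖ : ℝ) * W.realPeriodRat = plusPeriod f →
      ∃ m : ℕ, ‖PowerSeries.coeff m
        (PowerSeries.C (ϖ : ℚ_[p]) * padicLFunction f (unitRoot W p : ℚ_[p]))‖ = 1) :
    BSDp W p := by
  have hΔ : (⟨a1, a2, a3, a4, a6⟩ : WeierstrassCurve ℤ).Δ = discOf [a1, a2, a3, a4, a6] :=
    intCurve_Δ a1 a2 a3 a4 a6
  have hcm : ¬ W.HasCM := fun hCM ↦
    hj (j_eq_of_intModel a1 a2 a3 a4 a6 hW ▸ (hasCM_iff_j_mem_holds W).mp hCM)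
  have hgood : W.HasGoodReductionAtPrime p :=
    hasGoodReductionAtPrime_of_not_dvd W p (by rw [minimalDiscriminantInt_eq hW, hΔ]; exact hpΔ)
  have hord : ¬ (p : ℤ) ∣ W.frobeniusTrace p := by rw [frobeniusTrace_eq hW hcardp]; exact hordp
  have hirr : W.HasIrreducibleModPGaloisRep p := by
    refine hasIrreducibleModPGaloisRep_of_intModel_of_noroot hW p ℓ hℓp (by rw [hΔ]; exact hℓΔ) hcard
      (forall_zmod_of_forall_lt fun t ht h0 ↦ hnoroot t ht ?_)
    rw [← ZMod.intCast_zmod_eq_zero_iff_dvd]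
    push_cast at h0 ⊢
    linear_combination h0
  exact bsdp_of_cha_of_unitCoeff_of_analyticRank_eq_zero W p hBCS hGr h5 hmodP hmodL hGZK hCha hcm hp
    ⟨hgood, hord⟩ hirr hr hK hH hP hnt hpD hpN hI hq (by rw [hv]; norm_num) hcert

/-! ### Kernel data and records -/

/-- `#Ẽ(𝔽₅) = 4` (`a₅ = 2`: good ORDINARY) for Cremona's model `38088v1` (kernel count). [folklore] -/
theorem card_u38088v1_5 :
    Nat.card (((⟨0, 0, 0, 36501, -16230778⟩ : WeierstrassCurve ℤ).map
      (Int.castRingHom (ZMod 5))).toAffine.Point) = 4 := by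
  rw [@WeierstrassCurve.natCard_point_eq_one_add_card (ZMod 5) (@ZMod.instField 5 ⟨by norm_num⟩) _ _ _
    (by decide +kernel), @card_sol_eq_sum_euler (ZMod 5) (@ZMod.instField 5 ⟨by norm_num⟩) _ _
    (by rw [ZMod.ringChar_zmod_n]; decide), ZMod.card]
  decide +kernel

/-- `38088v1`'s Cremona model: `Δ ≠ 0` (kernel). [cite: Cremona2006, Table 1 (Cremona label 38088v1)] -/
theorem isElliptic_u38088v1 : (⟨0, 0, 0, 36501, -16230778⟩ : WeierstrassCurve ℚ).IsElliptic :=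
  isElliptic_of_discOf_ne_zero 0 0 0 36501 (-16230778) (by decide +kernel)

/-- `38088v1`'s Cremona model is globally minimal (Kraus' bounded criterion, kernel). [cite: SilvermanAEC2009, VII.1 Remark 1.1] -/
theorem isGloballyMinimal_u38088v1 : (⟨0, 0, 0, 36501, -16230778⟩ : WeierstrassCurve ℚ).IsGloballyMinimal :=
  isGloballyMinimal_of_krausCriterion_bounded₂ 0 0 0 36501 (-16230778) (by decide +kernel) (by decide +kernel)
    (by decide +kernel)

/-- **`BSD(E,5)` for `38088v1`, GRH-free** (`N = 38088 = 2³·3²·23²`; good ORDINARY at `5`, `a₅ = 2`, `#Ẽ(𝔽₅) = 4`; Cremona model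
`[0, 0, 0, 36501, -16230778]`; `ρ̄_{E,5}` irreducible (gen 13's Frobenius witness `ℓ = 11`: `#Ẽ(𝔽₁₁) = 16`, `a₁₁ = -4`, root-free mod `5`)
and of EXCEPTIONAL type `5S4` (census datum); non-CM (`j ∉` the CM list, kernel); analytic rank `0`; `#Ш_an = 25` (`ord₅ = 2`); c₂ = 1, c₃ = 1, c₂₃ = 1) —
lane LITERAL after R197.7 (X9D; the gen-13 kernel record `bsdp_c38088v1` has a [GRH] descent line as its lower half) — UPPER half Cha 2005 with the X9 census Heegner row `D = -143`, `[E(K):ℤy_K] = 20`, `ord₅ = 1` (two engines,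
`HOME/b2b-bsdres-x9/g13/fold/fold_g13.routes.tsv`), LOWER half `ord₅ #Ш ≥ 2` from the certificate `μ(𝓛₅(E)) = 0` (gen 9 `MU-ALL.tsv`,
engines B and C, `λ = 2`) through BCS 2025 Thm. 1.1.2 (a) + Greenberg Thm. 4.1 + the period unit + modularity + GZK — NO descent, NO
class group, NO GRH. Kernel-decided: non-CM, good ordinary at `5`, `E[5]` irreducible (`ChaDescentRecordsS4.card_c38088v1_11`), and — via
`isElliptic_u38088v1` / `isGloballyMinimal_u38088v1` — the instance binders. Binders: PUBLISHED `hBCS`, `hGr`, `h5`, `hmodP`, `hmodL`, `hGZK`, `hCha`;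
FINITE: `r_an = 0`, the Heegner datum with `ord₅ [E(K):ℤP] ≤ 1`, `#Ш_an = q` with `ord₅ q = 2`, `hcert`. Per pair; nothing booked.
[cite: Miller2011LMS, Thm. 5.2 and Def. 1.1] [cite: BurungaleCastellaSkinner2025, Thm. 1.1.2 (a) (p. 2 of arXiv:2405.00270v2)]
[cite: Cremona2006, Table 1 (Cremona label 38088v1)] -/
theorem bsdp_u38088v1
    (hBCS : burungale_castella_skinner_charIdeal_eq_padicLFunction)
    (hGr : greenberg_charValue_rankZero) (h5 : realPeriodRat_eq_unit_mul_plusPeriod)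
    (hmodP : nonempty_modularParametrizationData) (hmodL : hasEntireLFunction_rat)
    (hGZK : rank_eq_analyticRank_of_analyticRank_le_one) (hCha : Cha2005.thm52_padicValNat_shaOrder_le)
    (W : WeierstrassCurve ℚ) [W.IsElliptic] [W.IsGloballyMinimal] [Fact (Nat.Prime 5)]
    (hW : W = ⟨0, 0, 0, 36501, -16230778⟩) (hr : W.analyticRank = 0)
    {N : ℕ} [NeZero N] {K : Type} [Field K] [NumberField K] (hK : IsImaginaryQuadratic K)
    (hH : SatisfiesHeegnerHypothesis N K) {P : (W.baseChange K).toAffine.Point}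
    (hP : IsHeegnerPoint N W K P) (hnt : ¬ IsOfFinAddOrder P)
    (hpD : ¬ (5 : ℤ) ∣ NumberField.discr K) (hpN : ¬ 5 ^ 2 ∣ N)
    (hI : padicValNat 5 (AddSubgroup.zmultiples P).index ≤ 1)
    {q : ℚ} (hq : shaAn W = (q : ℂ)) (hv : padicValRat 5 q = 2)
    (hcert : ∀ [NeZero (W.conductorNorm ℤ)] (f : CuspForm (Gamma0 (W.conductorNorm ℤ)) 2),
        IsNewformOf W f → ∀ (ϖ : ℚ), (ϖ : ℝ) * W.realPeriodRat = plusPeriod f →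
      ∃ m : ℕ, ‖PowerSeries.coeff m
        (PowerSeries.C (ϖ : ℚ_[5]) * padicLFunction f (unitRoot W 5 : ℚ_[5]))‖ = 1) :
    BSDp W 5 := by
  have hIW : integralModelInt W = ⟨0, 0, 0, 36501, -16230778⟩ :=
    integralModelInt_eq_of_map_eq _ (by rw [hW]; ext <;> simp [WeierstrassCurve.map])
  haveI : Fact (Nat.Prime 11) := ⟨by norm_num⟩
  exact bsdp_of_ainvs_of_cha_of_unitCoeff hBCS hGr h5 hmodP hmodL hGZK hCha 0 0 0 36501 (-16230778) hIW 5 11 16 4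
    (by norm_num) (by decide +kernel) (by decide +kernel) card_u38088v1_5 (by decide) (by decide) (by decide +kernel)
    card_c38088v1_11 (by decide) hr hK hH hP hnt hpD hpN hI hq hv hcert

/-- `#Ẽ(𝔽₅) = 3` (`a₅ = 3`: good ORDINARY) for Cremona's model `464648c1` (kernel count). [folklore] -/
theorem card_u464648c1_5 :
    Nat.card (((⟨0, 0, 0, -153972731, -735401758298⟩ : WeierstrassCurve ℤ).map
      (Int.castRingHom (ZMod 5))).toAffine.Point) = 3 := by
  rw [@WeierstrassCurve.natCard_point_eq_one_add_card (ZMod 5) (@ZMod.instField 5 ⟨by norm_num⟩) _ _ _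
    (by decide +kernel), @card_sol_eq_sum_euler (ZMod 5) (@ZMod.instField 5 ⟨by norm_num⟩) _ _
    (by rw [ZMod.ringChar_zmod_n]; decide), ZMod.card]
  decide +kernel

/-- `464648c1`'s Cremona model: `Δ ≠ 0` (kernel). [cite: Cremona2006, Table 1 (Cremona label 464648c1)] -/
theorem isElliptic_u464648c1 : (⟨0, 0, 0, -153972731, -735401758298⟩ : WeierstrassCurve ℚ).IsElliptic :=
  isElliptic_of_discOf_ne_zero 0 0 0 (-153972731) (-735401758298) (by decide +kernel)

/-- `464648c1`'s Cremona model is globally minimal (Kraus' bounded criterion, kernel). [cite: SilvermanAEC2009, VII.1 Remark 1.1] -/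
theorem isGloballyMinimal_u464648c1 : (⟨0, 0, 0, -153972731, -735401758298⟩ : WeierstrassCurve ℚ).IsGloballyMinimal :=
  isGloballyMinimal_of_krausCriterion_bounded₂ 0 0 0 (-153972731) (-735401758298) (by decide +kernel) (by decide +kernel)
    (by decide +kernel)

/-- **`BSD(E,5)` for `464648c1`, GRH-free** (`N = 464648 = 2³·3·19·1019`; good ORDINARY at `5`, `a₅ = 3`, `#Ẽ(𝔽₅) = 3`; Cremona model
`[0, 0, 0, -153972731, -735401758298]`; `ρ̄_{E,5}` irreducible (gen 13's Frobenius witness `ℓ = 3`: `#Ẽ(𝔽₃) = 4`, `a₃ = 0`, root-free mod `5`)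
and of EXCEPTIONAL type `5S4` (census datum); non-CM (`j ∉` the CM list, kernel); analytic rank `0`; `#Ш_an = 100` (`ord₅ = 2`); ∏c_ℓ = 2) —
lane LITERAL after R197.7 (gen-13 record `bsdp_c464648c1`: descent line [GRH]) — UPPER half Cha 2005 with the X9 census Heegner row `D = -79`, `[E(K):ℤy_K] = 40`, `ord₅ = 1` (two engines,
`HOME/b2b-bsdres-x9/g13/fold/fold_g13.routes.tsv`), LOWER half `ord₅ #Ш ≥ 2` from the certificate `μ(𝓛₅(E)) = 0` (gen 9 `MU-ALL.tsv`,
engines B and C, `λ = 2`) through BCS 2025 Thm. 1.1.2 (a) + Greenberg Thm. 4.1 + the period unit + modularity + GZK — NO descent, NO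
class group, NO GRH. Kernel-decided: non-CM, good ordinary at `5`, `E[5]` irreducible (`ChaDescentRecordsS4.card_c464648c1_3`), and — via
`isElliptic_u464648c1` / `isGloballyMinimal_u464648c1` — the instance binders. Binders: PUBLISHED `hBCS`, `hGr`, `h5`, `hmodP`, `hmodL`, `hGZK`, `hCha`;
FINITE: `r_an = 0`, the Heegner datum with `ord₅ [E(K):ℤP] ≤ 1`, `#Ш_an = q` with `ord₅ q = 2`, `hcert`. Per pair; nothing booked.
[cite: Miller2011LMS, Thm. 5.2 and Def. 1.1] [cite: BurungaleCastellaSkinner2025, Thm. 1.1.2 (a) (p. 2 of arXiv:2405.00270v2)]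
[cite: Cremona2006, Table 1 (Cremona label 464648c1)] -/
theorem bsdp_u464648c1
    (hBCS : burungale_castella_skinner_charIdeal_eq_padicLFunction)
    (hGr : greenberg_charValue_rankZero) (h5 : realPeriodRat_eq_unit_mul_plusPeriod)
    (hmodP : nonempty_modularParametrizationData) (hmodL : hasEntireLFunction_rat)
    (hGZK : rank_eq_analyticRank_of_analyticRank_le_one) (hCha : Cha2005.thm52_padicValNat_shaOrder_le)
    (W : WeierstrassCurve ℚ) [W.IsElliptic] [W.IsGloballyMinimal] [Fact (Nat.Prime 5)]
    (hW : W = ⟨0, 0, 0, -153972731, -735401758298⟩) (hr : W.analyticRank = 0)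
    {N : ℕ} [NeZero N] {K : Type} [Field K] [NumberField K] (hK : IsImaginaryQuadratic K)
    (hH : SatisfiesHeegnerHypothesis N K) {P : (W.baseChange K).toAffine.Point}
    (hP : IsHeegnerPoint N W K P) (hnt : ¬ IsOfFinAddOrder P)
    (hpD : ¬ (5 : ℤ) ∣ NumberField.discr K) (hpN : ¬ 5 ^ 2 ∣ N)
    (hI : padicValNat 5 (AddSubgroup.zmultiples P).index ≤ 1)
    {q : ℚ} (hq : shaAn W = (q : ℂ)) (hv : padicValRat 5 q = 2)
    (hcert : ∀ [NeZero (W.conductorNorm ℤ)] (f : CuspForm (Gamma0 (W.conductorNorm ℤ)) 2),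
        IsNewformOf W f → ∀ (ϖ : ℚ), (ϖ : ℝ) * W.realPeriodRat = plusPeriod f →
      ∃ m : ℕ, ‖PowerSeries.coeff m
        (PowerSeries.C (ϖ : ℚ_[5]) * padicLFunction f (unitRoot W 5 : ℚ_[5]))‖ = 1) :
    BSDp W 5 := by
  have hIW : integralModelInt W = ⟨0, 0, 0, -153972731, -735401758298⟩ :=
    integralModelInt_eq_of_map_eq _ (by rw [hW]; ext <;> simp [WeierstrassCurve.map])
  haveI : Fact (Nat.Prime 3) := ⟨by norm_num⟩
  exact bsdp_of_ainvs_of_cha_of_unitCoeff hBCS hGr h5 hmodP hmodL hGZK hCha 0 0 0 (-153972731) (-735401758298) hIW 5 3 4 3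
    (by norm_num) (by decide +kernel) (by decide +kernel) card_u464648c1_5 (by decide) (by decide) (by decide +kernel)
    card_c464648c1_3 (by decide) hr hK hH hP hnt hpD hpN hI hq hv hcert

/-- `#Ẽ(𝔽₅) = 3` (`a₅ = 3`: good ORDINARY) for Cremona's model `219024bv1` (kernel count). [folklore] -/
theorem card_u219024bv1_5 :
    Nat.card (((⟨0, 0, 0, -6591, -206518⟩ : WeierstrassCurve ℤ).map
      (Int.castRingHom (ZMod 5))).toAffine.Point) = 3 := by
  rw [@WeierstrassCurve.natCard_point_eq_one_add_card (ZMod 5) (@ZMod.instField 5 ⟨by norm_num⟩) _ _ _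
    (by decide +kernel), @card_sol_eq_sum_euler (ZMod 5) (@ZMod.instField 5 ⟨by norm_num⟩) _ _
    (by rw [ZMod.ringChar_zmod_n]; decide), ZMod.card]
  decide +kernel

/-- `219024bv1`'s Cremona model: `Δ ≠ 0` (kernel). [cite: Cremona2006, Table 1 (Cremona label 219024bv1)] -/
theorem isElliptic_u219024bv1 : (⟨0, 0, 0, -6591, -206518⟩ : WeierstrassCurve ℚ).IsElliptic :=
  isElliptic_of_discOf_ne_zero 0 0 0 (-6591) (-206518) (by decide +kernel)

/-- `219024bv1`'s Cremona model is globally minimal (Kraus' bounded criterion, kernel). [cite: SilvermanAEC2009, VII.1 Remark 1.1] -/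
theorem isGloballyMinimal_u219024bv1 : (⟨0, 0, 0, -6591, -206518⟩ : WeierstrassCurve ℚ).IsGloballyMinimal :=
  isGloballyMinimal_of_krausCriterion_bounded₂ 0 0 0 (-6591) (-206518) (by decide +kernel) (by decide +kernel)
    (by decide +kernel)

/-- **`BSD(E,5)` for `219024bv1`, GRH-free** (`N = 219024 = 2⁴·3⁴·13²`; good ORDINARY at `5`, `a₅ = 3`, `#Ẽ(𝔽₅) = 3`; Cremona model
`[0, 0, 0, -6591, -206518]`; `ρ̄_{E,5}` irreducible (gen 13's Frobenius witness `ℓ = 11`: `#Ẽ(𝔽₁₁) = 6`, `a₁₁ = 6`, root-free mod `5`)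
and of EXCEPTIONAL type `5S4` (census datum); non-CM (`j ∉` the CM list, kernel); analytic rank `0`; `#Ш_an = 25` (`ord₅ = 2`); ∏c_ℓ = 1) —
X9 cell closed (R197.7) but class still residue on an X3 cell (gen-13 record `bsdp_c219024bv1`: descent line [GRH]) — UPPER half Cha 2005 with the X9 census Heegner row `D = -23`, `[E(K):ℤy_K] = 10`, `ord₅ = 1` (two engines,
`HOME/b2b-bsdres-x9/g13/fold/fold_g13.routes.tsv`), LOWER half `ord₅ #Ш ≥ 2` from the certificate `μ(𝓛₅(E)) = 0` (gen 9 `MU-ALL.tsv`,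
engines B and C, `λ = 2`) through BCS 2025 Thm. 1.1.2 (a) + Greenberg Thm. 4.1 + the period unit + modularity + GZK — NO descent, NO
class group, NO GRH. Kernel-decided: non-CM, good ordinary at `5`, `E[5]` irreducible (`ChaDescentRecordsS4b.card_c219024bv1_11`), and — via
`isElliptic_u219024bv1` / `isGloballyMinimal_u219024bv1` — the instance binders. Binders: PUBLISHED `hBCS`, `hGr`, `h5`, `hmodP`, `hmodL`, `hGZK`, `hCha`;
FINITE: `r_an = 0`, the Heegner datum with `ord₅ [E(K):ℤP] ≤ 1`, `#Ш_an = q` with `ord₅ q = 2`, `hcert`. Per pair; nothing booked.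
[cite: Miller2011LMS, Thm. 5.2 and Def. 1.1] [cite: BurungaleCastellaSkinner2025, Thm. 1.1.2 (a) (p. 2 of arXiv:2405.00270v2)]
[cite: Cremona2006, Table 1 (Cremona label 219024bv1)] -/
theorem bsdp_u219024bv1
    (hBCS : burungale_castella_skinner_charIdeal_eq_padicLFunction)
    (hGr : greenberg_charValue_rankZero) (h5 : realPeriodRat_eq_unit_mul_plusPeriod)
    (hmodP : nonempty_modularParametrizationData) (hmodL : hasEntireLFunction_rat)
    (hGZK : rank_eq_analyticRank_of_analyticRank_le_one) (hCha : Cha2005.thm52_padicValNat_shaOrder_le)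
    (W : WeierstrassCurve ℚ) [W.IsElliptic] [W.IsGloballyMinimal] [Fact (Nat.Prime 5)]
    (hW : W = ⟨0, 0, 0, -6591, -206518⟩) (hr : W.analyticRank = 0)
    {N : ℕ} [NeZero N] {K : Type} [Field K] [NumberField K] (hK : IsImaginaryQuadratic K)
    (hH : SatisfiesHeegnerHypothesis N K) {P : (W.baseChange K).toAffine.Point}
    (hP : IsHeegnerPoint N W K P) (hnt : ¬ IsOfFinAddOrder P)
    (hpD : ¬ (5 : ℤ) ∣ NumberField.discr K) (hpN : ¬ 5 ^ 2 ∣ N)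
    (hI : padicValNat 5 (AddSubgroup.zmultiples P).index ≤ 1)
    {q : ℚ} (hq : shaAn W = (q : ℂ)) (hv : padicValRat 5 q = 2)
    (hcert : ∀ [NeZero (W.conductorNorm ℤ)] (f : CuspForm (Gamma0 (W.conductorNorm ℤ)) 2),
        IsNewformOf W f → ∀ (ϖ : ℚ), (ϖ : ℝ) * W.realPeriodRat = plusPeriod f →
      ∃ m : ℕ, ‖PowerSeries.coeff m
        (PowerSeries.C (ϖ : ℚ_[5]) * padicLFunction f (unitRoot W 5 : ℚ_[5]))‖ = 1) :
    BSDp W 5 := by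
  have hIW : integralModelInt W = ⟨0, 0, 0, -6591, -206518⟩ :=
    integralModelInt_eq_of_map_eq _ (by rw [hW]; ext <;> simp [WeierstrassCurve.map])
  haveI : Fact (Nat.Prime 11) := ⟨by norm_num⟩
  exact bsdp_of_ainvs_of_cha_of_unitCoeff hBCS hGr h5 hmodP hmodL hGZK hCha 0 0 0 (-6591) (-206518) hIW 5 11 6 3
    (by norm_num) (by decide +kernel) (by decide +kernel) card_u219024bv1_5 (by decide) (by decide) (by decide +kernel)
    card_c219024bv1_11 (by decide) hr hK hH hP hnt hpD hpN hI hq hv hcert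

/-- `#Ẽ(𝔽₅) = 3` (`a₅ = 3`: good ORDINARY) for Cremona's model `219024bv2` (kernel count). [folklore] -/
theorem card_u219024bv2_5 :
    Nat.card (((⟨0, 0, 0, 13689, -1067742⟩ : WeierstrassCurve ℤ).map
      (Int.castRingHom (ZMod 5))).toAffine.Point) = 3 := by
  rw [@WeierstrassCurve.natCard_point_eq_one_add_card (ZMod 5) (@ZMod.instField 5 ⟨by norm_num⟩) _ _ _
    (by decide +kernel), @card_sol_eq_sum_euler (ZMod 5) (@ZMod.instField 5 ⟨by norm_num⟩) _ _
    (by rw [ZMod.ringChar_zmod_n]; decide), ZMod.card]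
  decide +kernel

/-- `219024bv2`'s Cremona model: `Δ ≠ 0` (kernel). [cite: Cremona2006, Table 1 (Cremona label 219024bv2)] -/
theorem isElliptic_u219024bv2 : (⟨0, 0, 0, 13689, -1067742⟩ : WeierstrassCurve ℚ).IsElliptic :=
  isElliptic_of_discOf_ne_zero 0 0 0 13689 (-1067742) (by decide +kernel)

/-- `219024bv2`'s Cremona model is globally minimal (Kraus' bounded criterion, kernel). [cite: SilvermanAEC2009, VII.1 Remark 1.1] -/
theorem isGloballyMinimal_u219024bv2 : (⟨0, 0, 0, 13689, -1067742⟩ : WeierstrassCurve ℚ).IsGloballyMinimal :=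
  isGloballyMinimal_of_krausCriterion_bounded₂ 0 0 0 13689 (-1067742) (by decide +kernel) (by decide +kernel)
    (by decide +kernel)

/-- **`BSD(E,5)` for `219024bv2`, GRH-free** (`N = 219024 = 2⁴·3⁴·13²`; good ORDINARY at `5`, `a₅ = 3`, `#Ẽ(𝔽₅) = 3`; Cremona model
`[0, 0, 0, 13689, -1067742]`; `ρ̄_{E,5}` irreducible (gen 13's Frobenius witness `ℓ = 11`: `#Ẽ(𝔽₁₁) = 6`, `a₁₁ = 6`, root-free mod `5`)
and of EXCEPTIONAL type `5S4` (census datum); non-CM (`j ∉` the CM list, kernel); analytic rank `0`; `#Ш_an = 25` (`ord₅ = 2`); ∏c_ℓ = 1) —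
3-isogenous to 219024bv1 (gen-13 record `bsdp_c219024bv2`: descent line [GRH]) — UPPER half Cha 2005 with the X9 census Heegner row `D = -23`, `[E(K):ℤy_K] = 10`, `ord₅ = 1` (two engines,
`HOME/b2b-bsdres-x9/g13/fold/fold_g13.routes.tsv`), LOWER half `ord₅ #Ш ≥ 2` from the certificate `μ(𝓛₅(E)) = 0` (gen 9 `MU-ALL.tsv`,
engines B and C, `λ = 2`) through BCS 2025 Thm. 1.1.2 (a) + Greenberg Thm. 4.1 + the period unit + modularity + GZK — NO descent, NO
class group, NO GRH. Kernel-decided: non-CM, good ordinary at `5`, `E[5]` irreducible (`ChaDescentRecordsS4b.card_c219024bv2_11`), and — via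
`isElliptic_u219024bv2` / `isGloballyMinimal_u219024bv2` — the instance binders. Binders: PUBLISHED `hBCS`, `hGr`, `h5`, `hmodP`, `hmodL`, `hGZK`, `hCha`;
FINITE: `r_an = 0`, the Heegner datum with `ord₅ [E(K):ℤP] ≤ 1`, `#Ш_an = q` with `ord₅ q = 2`, `hcert`. Per pair; nothing booked.
[cite: Miller2011LMS, Thm. 5.2 and Def. 1.1] [cite: BurungaleCastellaSkinner2025, Thm. 1.1.2 (a) (p. 2 of arXiv:2405.00270v2)]
[cite: Cremona2006, Table 1 (Cremona label 219024bv2)] -/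
theorem bsdp_u219024bv2
    (hBCS : burungale_castella_skinner_charIdeal_eq_padicLFunction)
    (hGr : greenberg_charValue_rankZero) (h5 : realPeriodRat_eq_unit_mul_plusPeriod)
    (hmodP : nonempty_modularParametrizationData) (hmodL : hasEntireLFunction_rat)
    (hGZK : rank_eq_analyticRank_of_analyticRank_le_one) (hCha : Cha2005.thm52_padicValNat_shaOrder_le)
    (W : WeierstrassCurve ℚ) [W.IsElliptic] [W.IsGloballyMinimal] [Fact (Nat.Prime 5)]
    (hW : W = ⟨0, 0, 0, 13689, -1067742⟩) (hr : W.analyticRank = 0)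
    {N : ℕ} [NeZero N] {K : Type} [Field K] [NumberField K] (hK : IsImaginaryQuadratic K)
    (hH : SatisfiesHeegnerHypothesis N K) {P : (W.baseChange K).toAffine.Point}
    (hP : IsHeegnerPoint N W K P) (hnt : ¬ IsOfFinAddOrder P)
    (hpD : ¬ (5 : ℤ) ∣ NumberField.discr K) (hpN : ¬ 5 ^ 2 ∣ N)
    (hI : padicValNat 5 (AddSubgroup.zmultiples P).index ≤ 1)
    {q : ℚ} (hq : shaAn W = (q : ℂ)) (hv : padicValRat 5 q = 2)
    (hcert : ∀ [NeZero (W.conductorNorm ℤ)] (f : CuspForm (Gamma0 (W.conductorNorm ℤ)) 2),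
        IsNewformOf W f → ∀ (ϖ : ℚ), (ϖ : ℝ) * W.realPeriodRat = plusPeriod f →
      ∃ m : ℕ, ‖PowerSeries.coeff m
        (PowerSeries.C (ϖ : ℚ_[5]) * padicLFunction f (unitRoot W 5 : ℚ_[5]))‖ = 1) :
    BSDp W 5 := by
  have hIW : integralModelInt W = ⟨0, 0, 0, 13689, -1067742⟩ :=
    integralModelInt_eq_of_map_eq _ (by rw [hW]; ext <;> simp [WeierstrassCurve.map])
  haveI : Fact (Nat.Prime 11) := ⟨by norm_num⟩
  exact bsdp_of_ainvs_of_cha_of_unitCoeff hBCS hGr h5 hmodP hmodL hGZK hCha 0 0 0 13689 (-1067742) hIW 5 11 6 3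
    (by norm_num) (by decide +kernel) (by decide +kernel) card_u219024bv2_5 (by decide) (by decide) (by decide +kernel)
    card_c219024bv2_11 (by decide) hr hK hH hP hnt hpD hpN hI hq hv hcert

end Summit.BirchSwinnertonDyer.Rank1Residual.X9

end
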